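import Summits.QuantumAdvantage.QuantumAdvantage.Theorems.CubicForrelationNearExactIsExactTwelveLevelSixPartnerTools
import Summits.QuantumAdvantage.QuantumAdvantage.Theorems.CubicForrelationNearExactIsExactTwelveZ768WindowDead

/-!
# Crux `CubicForrelation.NearExactIsExact` (stmt-QuantumAdvantage-14043) — n = 12: NO level-`≥ 6` side on the OPEN window `57/64 < Φ < 29/32`;
  a cubic `g` on 12 bits with `W_g ∈ 64ℤ` has `Φ(f,g) ≤ 57/64` or `Φ(f,g) = 1` against EVERY cubic `f`

Certificate seat `b2b-cforr-cert` (gen 27).  HONEST FRAMING: a kernel-checked finite-slice theorem (standard axioms) about cubic Boolean pairs on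
12 bits.  With …TwelveLevelSixBothLe5764 (level 6 × level 6) it removes EVERY pairing that involves a level-`≥ 6` side from the open window, for
all sixteen undecided values `913/1024 … 928/1024` at once: a hypothetical pair in the window has BOTH sides of type O (`W/16` odd) or level 5
(`W ∈ 32ℤ`, `W/32` odd on a hyperplane).  NO new value of `θ₁₂` (`θ₁₂ ∈ [57/64, 14847/16384]` unchanged); NOT summit progress.  Tight:
`Negative/F8ChainTwelve` (`Φ = 57/64`) has both sides at level 6.

THE ARGUMENT (`tz_levelSix_window_false`).  `W_g = 64u''`, `e = u'' − (−1)^f`, `Z = {u'' even}`, `B = Σe² ≤ 895`; the partner `f` has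
`W_f = 16u_f` (Ax).  By `tzp_Z_card`, `#Z ∈ {512, 768}`.
* `#Z = 512` (9-flat): the mod-4 sign `σ` of `e` is affine on `Z` (…TwelveZ512SignAffine), its character sum `M ∈ {0, ±512}` lives on `8`
  frequencies, and `Σ(e − σ1_Z)² ≤ 507` whatever the partner (…TwelveZ512PiBound); Parseval + duality `ê = 64(−1)^g − W_f` give
  `Σ_y (64(−1)^g − W_f − M)² ≤ 4096·507 = 2 076 672` (`tzp_bridge512`).  A TYPE-O partner (`u_f` odd everywhere, `≡ ±1 (mod 8)` on a cubic
  support `E` of `≥ 512` points, `tzp_typeO_struct`) makes the summand `256(u_f − 4s)² ≥ 256` off the 8 frequencies and `≥ 2304` on `E`: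
  total `≥ 256·4096 + 2048·512 − 2304·8 = 2 078 720`.  A LEVEL-5 partner (`u_f = 2u′`, `u′` odd on `≥ 2048` points, `tzp_levelFive_card`)
  makes it `1024(u′ − 2s)² ≥ 1024` there: total `≥ 1024·2040 = 2 088 960`.  A level-`≥ 6` partner is …TwelveLevelSixBothLe5764.
* `#Z = 768`: `4 ∣ e` off `Z` (gen 26 `tzo_off_div4_le127`), the signed indicator has `Ŝ ∈ 128ℤ` everywhere and `Σ(e − S)² ≤ 254`
  (…TwelveZ768Core), so `Σ_y (64(−1)^g − W_f − 128K)² ≤ 4096·254 = 1 040 384` (`tzp_bridge768`); type O: every summand is `256·odd² ≥ 256`,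
  total `≥ 1 048 576`; level 5: `1024·odd²` on `≥ 2048` frequencies, total `≥ 2 097 152`; level `≥ 6`: gen 26 `tzw_Z768_window_false`.

Main statements: `tz_levelSix_window_false`, `tz_levelSix_le_5764`, `tz_levelSix_isolation`, `tz_window_sides_not_levelSix`.

References: J. Ax (1964); T. Kasami, N. Tokura (1970); MacWilliams–Sloane (1977) Ch. 13–15; R. O'Donnell (2014) §1.4, §3.3; O. Rothaus (1976).
Axioms: the standard three.
-/

set_option linter.dupNamespace false -- D-0017: single-problem summit ⇒ `QuantumAdvantage.QuantumAdvantage` by design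

noncomputable section

namespace Summit.QuantumAdvantage.QuantumAdvantage.Theorems.CubicForrelation.NearExactIsExact

open Finset
open Literature.Computability.QuantumComplexity
open Literature.Computability.QuantumComplexity.BuzetChailloux (bxor zeroVec bxor_bxor_cancel_left bxor_zeroVec zeroVec_bxor bxor_comm
  bxor_self)
open Literature.Computability.QuantumComplexity.DerivativeWalsh (W)

/-! ### Pointwise lower bounds for the partner's summand -/

/-- Type-O summand: `u` odd, `s = ±1` ⇒ `(64s − 16u)² ≥ 256`, and `≥ 2304` if `u ≡ ±1 (mod 8)`. [folklore] -/
theorem tzp_typeO_pt (u s K : ℤ) (hu : Odd u) (hs : s = 1 ∨ s = -1) :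
    (256 : ℤ) ≤ (64 * s - 16 * u - 128 * K) ^ 2 ∧ ((u % 8 = 1 ∨ u % 8 = 7) → K = 0 → (2304 : ℤ) ≤ (64 * s - 16 * u - 128 * K) ^ 2) := by
  have ho := Int.odd_iff.1 hu
  have e : (64 * s - 16 * u - 128 * K) ^ 2 = 256 * (u + 8 * K - 4 * s) ^ 2 := by ring
  rw [e]
  constructor
  · have h : u + 8 * K - 4 * s ≤ -1 ∨ 1 ≤ u + 8 * K - 4 * s := by rcases hs with rfl | rfl <;> omega
    have := tp_sq_ge (k := 1) (by norm_num) h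
    linarith
  · intro hE hK
    subst hK
    have h : u + 8 * 0 - 4 * s ≤ -3 ∨ 3 ≤ u + 8 * 0 - 4 * s := by rcases hs with rfl | rfl <;> omega
    have := tp_sq_ge (k := 3) (by norm_num) h
    linarith

/-- Level-5 summand: `u′` odd, `s = ±1` ⇒ `(64s − 32u′ − 128K)² ≥ 1024`. [folklore] -/
theorem tzp_levelFive_pt (u' s K : ℤ) (hu' : Odd u') (hs : s = 1 ∨ s = -1) : (1024 : ℤ) ≤ (64 * s - 32 * u' - 128 * K) ^ 2 := by
  have ho := Int.odd_iff.1 hu'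
  have e : (64 * s - 32 * u' - 128 * K) ^ 2 = 1024 * (u' + 4 * K - 2 * s) ^ 2 := by ring
  rw [e]
  have h : u' + 4 * K - 2 * s ≤ -1 ∨ 1 ≤ u' + 4 * K - 2 * s := by rcases hs with rfl | rfl <;> omega
  have := tp_sq_ge (k := 1) (by norm_num) h
  linarith

/-! ### The theorem -/

/-- **No level-`≥ 6` side on the open window** (module docstring): cubic `f, g` on 12 bits with `W_g = 64u''` and `57/64 < Φ(f,g) < 1` do
not exist — whatever the Ax type of `f`.  Finite-slice statement, NOT summit progress. [this work] -/
theorem tz_levelSix_window_false (f g : (Fin (6 + 6) → Bool) → Bool) (hf : IsDegLeFun 3 f) (hg : IsDegLeFun 3 g)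
    (u'' : (Fin (6 + 6) → Bool) → ℤ) (hu'' : ∀ x, W (fun y => signOf (g y)) x = (2 : ℝ) ^ 6 * (u'' x : ℝ))
    (hlo : (57 / 64 : ℝ) < forrelation f g) (hhi : forrelation f g < 1) : False := by
  classical
  set Z := univ.filter (fun x : Fin (6 + 6) → Bool => ¬ Odd (u'' x)) with hZdef
  -- the partner's spectrum at the Ax level: `W_f = 16 u₄`
  obtain ⟨u₄, hu₄⟩ := tw_base (n := 6 + 6) f hf 4 (by norm_num)
  -- budget facts for the `g`-side
  obtain ⟨hBR, -, hoffle⟩ := tzw_budget_split f g u'' hu''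
  have hB : (∑ x, (u'' x - sZ (f x)) ^ 2 : ℤ) ≤ 895 := by
    have h' : ((∑ x, (u'' x - sZ (f x)) ^ 2 : ℤ) : ℝ) < 896 := by rw [hBR]; linarith
    have h'' : (∑ x, (u'' x - sZ (f x)) ^ 2 : ℤ) < 896 := by exact_mod_cast h'
    omega
  -- level-5 / level-6 refinements of the partner
  have hcase5 : (∀ y, ¬ Odd (u₄ y)) → ∀ y, W (fun x => signOf (f x)) y = (2 : ℝ) ^ 5 * (((u₄ y / 2 : ℤ)) : ℝ) :=
    fun hev y => (tw_level_up (j := 4) f u₄ hu₄ hev y).trans (by norm_num)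
  have hcase6 : (∀ y, ¬ Odd (u₄ y)) → (∀ y, ¬ Odd (u₄ y / 2)) → ∀ y, W (fun x => signOf (f x)) y = (2 : ℝ) ^ 6 * (((u₄ y / 2 / 2 : ℤ)) : ℝ) :=
    fun hev hev' y => (tw_level_up (j := 5) f (fun y => u₄ y / 2) (hcase5 hev) hev' y).trans (by norm_num)
  rcases tzp_Z_card f g hf hg u'' hu'' hlo hhi with h512 | h768
  · -- `Z` is a 9-flat
    obtain ⟨V₀, xZ, h0, hadd, hcardV, hS⟩ := tzp_flat512 g hg u'' hu'' h512
    rw [h512] at hoffle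
    have hoff : ∑ x ∈ univ.filter (fun x => x ∉ Z), (u'' x - sZ (f x)) ^ 2 ≤ 511 := by push_cast at hoffle; linarith
    set hb : (Fin (6 + 6) → Bool) → Bool := fun x => decide ((u'' x - sZ (f x)) % 4 = 3) with hbdef
    set M : (Fin (6 + 6) → Bool) → ℝ := fun y => ∑ x ∈ Z, signOf (hb x) * twist x y with hMdef
    have hMv : ∀ y, M y = 0 ∨ M y = 512 ∨ M y = -512 :=
      fun y => tza_Shat_vals f g hf hg u'' hu'' V₀ xZ h0 hadd hcardV hS hoff y
    have hMsupp : #(univ.filter fun y => M y ≠ 0) = 8 := tza_Shat_support u'' hb h512 hMv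
    have hbridge : ∑ y, (64 * signOf (g y) - W (fun x => signOf (f x)) y - M y) ^ 2 ≤ 4096 * 507 :=
      tzp_bridge512 f g hf hg u'' hu'' V₀ xZ h0 hadd hcardV hS hlo
    have hindM : ∑ y, (if M y ≠ 0 then (1 : ℝ) else 0) = 8 := by
      rw [sum_boole, hMsupp]; norm_num
    by_cases hO : ∃ y, Odd (u₄ y)
    · -- type-O partner
      obtain ⟨hall, hEcard⟩ := tzp_typeO_struct f hf u₄ hu₄ hO
      set E := univ.filter (fun y : Fin (6 + 6) → Bool => u₄ y % 8 = 1 ∨ u₄ y % 8 = 7) with hEdef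
      have hpt : ∀ y, (256 : ℝ) + 2048 * (if y ∈ E then (1 : ℝ) else 0) - 2304 * (if M y ≠ 0 then (1 : ℝ) else 0) ≤
          (64 * signOf (g y) - W (fun x => signOf (f x)) y - M y) ^ 2 := by
        intro y
        have hint := tzp_typeO_pt (u₄ y) (sZ (g y)) 0 (hall y) (tp_sZ_cases (g y))
        by_cases hMy : M y = 0
        · rw [if_neg (not_not.2 hMy), hMy, hu₄ y, ← tp_sZ_cast (g y)]
          have e1 : (64 * ((sZ (g y) : ℤ) : ℝ) - (2 : ℝ) ^ 4 * (u₄ y : ℝ) - 0) ^ 2 =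
              (((64 * sZ (g y) - 16 * u₄ y - 128 * 0) ^ 2 : ℤ) : ℝ) := by push_cast; ring
          rw [e1]
          by_cases hyE : y ∈ E
          · rw [if_pos hyE]
            have h9 := hint.2 (mem_filter.1 hyE).2 rfl
            have : ((2304 : ℤ) : ℝ) ≤ (((64 * sZ (g y) - 16 * u₄ y - 128 * 0) ^ 2 : ℤ) : ℝ) := by exact_mod_cast h9
            norm_num at this ⊢; linarith
          · rw [if_neg hyE]
            have : ((256 : ℤ) : ℝ) ≤ (((64 * sZ (g y) - 16 * u₄ y - 128 * 0) ^ 2 : ℤ) : ℝ) := by exact_mod_cast hint.1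
            norm_num at this ⊢; linarith
        · rw [if_pos hMy]
          have h1 : (if y ∈ E then (1 : ℝ) else 0) ≤ 1 := by split_ifs <;> norm_num
          nlinarith [sq_nonneg (64 * signOf (g y) - W (fun x => signOf (f x)) y - M y)]
      have hsum := sum_le_sum fun y (_ : y ∈ (univ : Finset (Fin (6 + 6) → Bool))) => hpt y
      have hindE : ∑ y, (if y ∈ E then (1 : ℝ) else 0) = #E := by
        rw [sum_boole]
        have : (univ.filter fun y => y ∈ E) = E := by ext y; simp
        rw [this]
      have hconst : ∑ _y : Fin (6 + 6) → Bool, (256 : ℝ) = 1048576 := by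
        rw [sum_const, card_univ, Fintype.card_fun, Fintype.card_bool, Fintype.card_fin, nsmul_eq_mul]; norm_num
      rw [sum_sub_distrib, sum_add_distrib, ← mul_sum, ← mul_sum, hindE, hindM, hconst] at hsum
      have hE' : (512 : ℝ) ≤ #E := by exact_mod_cast hEcard
      linarith
    · push Not at hO
      have hu₅ := hcase5 hO
      by_cases h5 : ∃ y, Odd (u₄ y / 2)
      · -- level-5 partner
        have hPcard := tzp_levelFive_card f hf (fun y => u₄ y / 2) hu₅ h5
        set P' := univ.filter (fun y : Fin (6 + 6) → Bool => Odd (u₄ y / 2)) with hP'def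
        have hpt : ∀ y, (1024 : ℝ) * (if y ∈ P' then (1 : ℝ) else 0) - 1024 * (if M y ≠ 0 then (1 : ℝ) else 0) ≤
            (64 * signOf (g y) - W (fun x => signOf (f x)) y - M y) ^ 2 := by
          intro y
          by_cases hMy : M y = 0
          · rw [if_neg (not_not.2 hMy), hMy, hu₅ y, ← tp_sZ_cast (g y)]
            have e1 : (64 * ((sZ (g y) : ℤ) : ℝ) - (2 : ℝ) ^ 5 * (((u₄ y / 2 : ℤ)) : ℝ) - 0) ^ 2 =
                (((64 * sZ (g y) - 32 * (u₄ y / 2) - 128 * 0) ^ 2 : ℤ) : ℝ) := by push_cast; ring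
            rw [e1]
            by_cases hyP : y ∈ P'
            · rw [if_pos hyP]
              have h1 := tzp_levelFive_pt (u₄ y / 2) (sZ (g y)) 0 (mem_filter.1 hyP).2 (tp_sZ_cases (g y))
              have : ((1024 : ℤ) : ℝ) ≤ (((64 * sZ (g y) - 32 * (u₄ y / 2) - 128 * 0) ^ 2 : ℤ) : ℝ) := by exact_mod_cast h1
              norm_num at this ⊢; linarith
            · rw [if_neg hyP]
              have : (0 : ℝ) ≤ (((64 * sZ (g y) - 32 * (u₄ y / 2) - 128 * 0) ^ 2 : ℤ) : ℝ) := by positivity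
              norm_num at this ⊢; linarith
          · rw [if_pos hMy]
            have h1 : (if y ∈ P' then (1 : ℝ) else 0) ≤ 1 := by split_ifs <;> norm_num
            nlinarith [sq_nonneg (64 * signOf (g y) - W (fun x => signOf (f x)) y - M y)]
        have hsum := sum_le_sum fun y (_ : y ∈ (univ : Finset (Fin (6 + 6) → Bool))) => hpt y
        have hindP : ∑ y, (if y ∈ P' then (1 : ℝ) else 0) = #P' := by
          rw [sum_boole]
          have : (univ.filter fun y => y ∈ P') = P' := by ext y; simp
          rw [this]
        rw [sum_sub_distrib, ← mul_sum, ← mul_sum, hindP, hindM] at hsum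
        have hP'' : (2048 : ℝ) ≤ #P' := by exact_mod_cast hPcard
        linarith
      · -- level-`≥ 6` partner
        push Not at h5
        exact tz_levelSix_both_window_false f g hf hg u'' hu'' (fun y => u₄ y / 2 / 2) (hcase6 hO h5) hlo hhi
  · -- `#Z = 768`
    rw [h768] at hoffle
    have hoff : ∑ x ∈ univ.filter (fun x => x ∉ Z), (u'' x - sZ (f x)) ^ 2 ≤ 127 := by push_cast at hoffle; linarith
    have h4off := tzo_off_div4_le127 f g hf hg u'' hu'' h768 hoff
    obtain ⟨K, hbridge⟩ := tzp_bridge768 f g hf hg u'' hu'' h768 h4off hlo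
    by_cases hO : ∃ y, Odd (u₄ y)
    · -- type-O partner: every summand is `≥ 256`
      have hall : ∀ y, Odd (u₄ y) := (tzp_typeO_struct f hf u₄ hu₄ hO).1
      have hpt : ∀ y, (256 : ℝ) ≤ (64 * signOf (g y) - W (fun x => signOf (f x)) y - 128 * (K y : ℝ)) ^ 2 := by
        intro y
        rw [hu₄ y, ← tp_sZ_cast (g y)]
        have e1 : (64 * ((sZ (g y) : ℤ) : ℝ) - (2 : ℝ) ^ 4 * (u₄ y : ℝ) - 128 * (K y : ℝ)) ^ 2 =
            (((64 * sZ (g y) - 16 * u₄ y - 128 * K y) ^ 2 : ℤ) : ℝ) := by push_cast; ring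
        rw [e1]
        exact_mod_cast (tzp_typeO_pt (u₄ y) (sZ (g y)) (K y) (hall y) (tp_sZ_cases (g y))).1
      have hsum := sum_le_sum fun y (_ : y ∈ (univ : Finset (Fin (6 + 6) → Bool))) => hpt y
      have hconst : ∑ _y : Fin (6 + 6) → Bool, (256 : ℝ) = 1048576 := by
        rw [sum_const, card_univ, Fintype.card_fun, Fintype.card_bool, Fintype.card_fin, nsmul_eq_mul]; norm_num
      rw [hconst] at hsum
      linarith
    · push Not at hO
      have hu₅ := hcase5 hO
      by_cases h5 : ∃ y, Odd (u₄ y / 2)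
      · -- level-5 partner: `≥ 1024` on `≥ 2048` frequencies
        have hPcard := tzp_levelFive_card f hf (fun y => u₄ y / 2) hu₅ h5
        set P' := univ.filter (fun y : Fin (6 + 6) → Bool => Odd (u₄ y / 2)) with hP'def
        have hpt : ∀ y, (1024 : ℝ) * (if y ∈ P' then (1 : ℝ) else 0) ≤
            (64 * signOf (g y) - W (fun x => signOf (f x)) y - 128 * (K y : ℝ)) ^ 2 := by
          intro y
          rw [hu₅ y, ← tp_sZ_cast (g y)]
          have e1 : (64 * ((sZ (g y) : ℤ) : ℝ) - (2 : ℝ) ^ 5 * (((u₄ y / 2 : ℤ)) : ℝ) - 128 * (K y : ℝ)) ^ 2 =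
              (((64 * sZ (g y) - 32 * (u₄ y / 2) - 128 * K y) ^ 2 : ℤ) : ℝ) := by push_cast; ring
          rw [e1]
          by_cases hyP : y ∈ P'
          · rw [if_pos hyP, mul_one]
            exact_mod_cast tzp_levelFive_pt (u₄ y / 2) (sZ (g y)) (K y) (mem_filter.1 hyP).2 (tp_sZ_cases (g y))
          · rw [if_neg hyP, mul_zero]
            positivity
        have hsum := sum_le_sum fun y (_ : y ∈ (univ : Finset (Fin (6 + 6) → Bool))) => hpt y
        have hindP : ∑ y, (if y ∈ P' then (1 : ℝ) else 0) = #P' := by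
          rw [sum_boole]
          have : (univ.filter fun y => y ∈ P') = P' := by ext y; simp
          rw [this]
        rw [← mul_sum, hindP] at hsum
        have hP'' : (2048 : ℝ) ≤ #P' := by exact_mod_cast hPcard
        linarith
      · -- level-`≥ 6` partner
        push Not at h5
        exact tzw_Z768_window_false f g hf hg u'' hu'' (fun y => u₄ y / 2 / 2) (hcase6 hO h5) h768 hlo hhi

/-- **A cubic on 12 bits with `W_g ∈ 64ℤ` has `Φ(f,g) ≤ 57/64` or `Φ(f,g) = 1` against every cubic `f`** (tight: `Negative/F8ChainTwelve`).
Finite-slice statement, NOT summit progress. [this work] -/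
theorem tz_levelSix_le_5764 (f g : (Fin (6 + 6) → Bool) → Bool) (hf : IsDegLeFun 3 f) (hg : IsDegLeFun 3 g)
    (u'' : (Fin (6 + 6) → Bool) → ℤ) (hu'' : ∀ x, W (fun y => signOf (g y)) x = (2 : ℝ) ^ 6 * (u'' x : ℝ))
    (hhi : forrelation f g < 1) : forrelation f g ≤ 57 / 64 := by
  by_contra h
  push Not at h
  exact tz_levelSix_window_false f g hf hg u'' hu'' h hhi

/-- **Isolation at `57/64` for a level-`≥ 6` side**: cubic `f, g` on 12 bits, `W_g ∈ 64ℤ`, `Φ(f,g) > 57/64` ⇒ `Φ(f,g) = 1`.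
Finite-slice statement, NOT summit progress. [this work] -/
theorem tz_levelSix_isolation (f g : (Fin (6 + 6) → Bool) → Bool) (hf : IsDegLeFun 3 f) (hg : IsDegLeFun 3 g)
    (u'' : (Fin (6 + 6) → Bool) → ℤ) (hu'' : ∀ x, W (fun y => signOf (g y)) x = (2 : ℝ) ^ 6 * (u'' x : ℝ))
    (hlo : (57 / 64 : ℝ) < forrelation f g) : forrelation f g = 1 := by
  have hle : forrelation f g ≤ 1 := (abs_le.1 (SgnForrMem.abs_forrelation_le_one f g)).2
  rcases eq_or_lt_of_le hle with h | h
  · exact h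
  · exact absurd h (fun hhi => tz_levelSix_window_false f g hf hg u'' hu'' hlo hhi)

/-- **On the open window both sides are type O or level 5**: for cubic `f, g` on 12 bits with `57/64 < Φ(f,g) < 1`, NEITHER Walsh
spectrum lies in `64ℤ` (by symmetry of `Φ`).  Finite-slice statement, NOT summit progress. [this work] -/
theorem tz_window_sides_not_levelSix (f g : (Fin (6 + 6) → Bool) → Bool) (hf : IsDegLeFun 3 f) (hg : IsDegLeFun 3 g)
    (hlo : (57 / 64 : ℝ) < forrelation f g) (hhi : forrelation f g < 1) :
    (¬ ∃ u'' : (Fin (6 + 6) → Bool) → ℤ, ∀ x, W (fun y => signOf (g y)) x = (2 : ℝ) ^ 6 * (u'' x : ℝ)) ∧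
    (¬ ∃ w : (Fin (6 + 6) → Bool) → ℤ, ∀ y, W (fun x => signOf (f x)) y = (2 : ℝ) ^ 6 * (w y : ℝ)) := by
  have hΦ' : forrelation g f = forrelation f g := by
    rw [Summit.QuantumAdvantage.QuantumAdvantage.Theorems.SignedCubicForrelationNotPrBPP.Negative.HalfQuad.forrelation_comm]
  refine ⟨fun ⟨u'', hu''⟩ => tz_levelSix_window_false f g hf hg u'' hu'' hlo hhi, fun ⟨w, hw⟩ => ?_⟩
  exact tz_levelSix_window_false g f hg hf w hw (by rw [hΦ']; exact hlo) (by rw [hΦ']; exact hhi)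

end Summit.QuantumAdvantage.QuantumAdvantage.Theorems.CubicForrelation.NearExactIsExact

end
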